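import Literature.NumberTheory.Rogawski1990.SingularObsHasse
import Literature.NumberTheory.QuadraticForms.HermitianDefiniteRealisation
import Literature.NumberTheory.NumberFields.TotallyPositivePrescribedSquareClass
import HarnessLib

/-!
# LOCAL REALISATION AT A SPLIT-SEMISIMPLE CLASS, finite places: every local class in the local stable class of `(γ₀)_v` is the `v`-component of a
# RATIONAL element of the stable class of `γ₀`
(Rogawski, *Automorphic Representations of Unitary Groups in Three Variables* (1990), §3.3 Prop. 3.3.1 p. 22, §3.8 Prop. 3.8.1 (a)(d) pp. 27–30;
Kottwitz (1986), §7, §9; Landherr (1936))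

Topic `NumberTheory/Rogawski1990`; namespace `Literature.NumberTheory.Rogawski1990`.  **THEOREMS ONLY** (no definition, no named fact, no instance, no notation,
no `sorry`).  Cell `pub/hodgecm-mathlib`, ENGINE T1 (crux H413 = `stmt-HodgeConjecture-24833`), row O7 «singular semisimple classes», piece **(LR-s)** (O7 OWNER
WORDS #19–#22): the hypothesis `hLR` of the (ANCHOR-s) certificate (F0P3a-p06) — the class-local admissibility pin (ix-adm) quantifies over the WHOLE local stable
class of `(γ₀)_v`, and the anchor's singular local families are admissible exactly at the local classes through a RATIONAL point.

THE MATHEMATICS.  `L` a CM field (`σ` complex conjugation, `L⁺` the maximal real subfield), `H ∈ M₃(L)` hermitian non-degenerate (ANY: the quasi-split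
`Φ₃` included — no anisotropy is used), `γ₀ ∈ U(H)(L⁺)` with `(γ₀ − a)(γ₀ − b) = 0`, `a ≠ b`.  For a finite place `v` of `L⁺` and `x ∈ U(H)(L⁺_v)`
corresponding to `(γ₀)_v` (★ `Corresponds`: conjugate in `GL₃(L ⊗ L⁺_v)`) there is a rational `δ ∈ U(H)(L⁺)` STABLY CONJUGATE to `γ₀` with `δ_v`
CONJUGATE TO `x` IN `U(H)(L⁺_v)` (**`exists_isStablyConj_and_isConj_toLocal_of_corresponds_local`**).  ROAD (the «CartanRealisation road», all inputs ★):
central `γ₀ = ζ•1` ⇒ `x = (γ₀)_v` (`isConj_toLocal_of_eq_smul_one`); otherwise frame `γ₀` (★ `exists_singular_frame`: `ᵗ(σP) H P = H_a ⊕ᶠ H_b`,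
`γ₀ P = P(a·1₂ ⊕ᶠ b·1₁)`); the transported form `H_{g′}` of a conjugator `x = g′ (γ₀)_v g′⁻¹` is block diagonal in the frame (★ `exists_twistGram_frame_eq_finSum`),
with rank-2 block `H_a·y₁`; its determinant class is represented by `a₁ ∈ L⁺_v` (`σ`-fixed units of `L ⊗ L⁺_v` come from `L⁺_v`,
`exists_toLocalRing_eq_of_conjLocal_eq`); choose `ξ ∈ L⁺` TOTALLY POSITIVE in the `v`-adic square class of `det y₁` (★
`NumberFields.exists_totallyPositive_eq_mul_sq` — weak approximation at `{v} ∪ ∞`, squares open); ★ (R6a-s) `exists_commute_hermStar_eq_of_frame` gives a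
global `⋆`-symmetric `y ∈ Z(γ₀)`, `det y = 1`, `ᵗ(σP)(H y)P = Y_a ⊕ᶠ Y_b`, `det Y_a = ξ det H_a`, with `H·y ≅ H` at every complex embedding (ξ ≫ 0); ★ R6a
`exists_unitary_conj_inv_mul_twistGram_eq_of_invariants` (Landherr) realises it: `g ∈ GL₃(L)`, `δ = g γ₀ g⁻¹ ∈ U(H)(L⁺)`, `H⁻¹ H_g = y`; at `v`, SPLIT places
need nothing (★ (h2) `exists_unitary_conj_of_split_frame`), NON-SPLIT places compare the rank-2 block determinants (★ (P1-s) `exists_unitary_conj_of_det_blocks`):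
`det (Y_a ⊗ 1) = ξ det H_a = det (H_a y₁) · s²` with `s` `σ`-fixed, i.e. a norm — so `δ_v ~ x`.  No parity bookkeeping: total positivity keeps every
archimedean signature, and the companion non-norm places of `ξ` forced by reciprocity are finite places other than `v`, which are not read.

* §1 letters: `conjLocal`-fixed units of `L ⊗ L⁺_v` are images of `L⁺_v` (`exists_toLocalRing_eq_of_conjLocal_eq`); determinants of hermitian matrices are
  `σ`-fixed (`map_det_eq_det_of_conjTranspose_eq`); the CENTRAL case (`isConj_toLocal_of_eq_smul_one`).
* §2 **`exists_isStablyConj_and_isConj_toLocal_of_corresponds_local`** and the `hLR` shape **`forall_exists_isStablyConj_and_isConj_toLocal_of_mul_sub_eq_zero`**.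
HC_CM is proved only modulo the printed citations until rung 0 closes; this file is unconditional.

## References
* [Rogawski1990] J. D. Rogawski, *Automorphic Representations of Unitary Groups in Three Variables*, Ann. of Math. Stud. 123 (1990), §3.3 Prop. 3.3.1 p. 22,
  §3.8 Prop. 3.8.1 (a)(d) pp. 27–30.
* [Kottwitz1986] R. E. Kottwitz, *Stable trace formula: elliptic singular terms*, Math. Ann. 275 (1986), §7, §9.
* [Landherr1936HermitianForms] W. Landherr, Abh. Math. Sem. Hamburg 11 (1936) 245–248.
-/

set_option autoImplicit false

noncomputable section

open NumberField IsDedekindDomain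
open scoped Matrix MatrixGroups

namespace Literature.NumberTheory.Rogawski1990

open Literature.NumberTheory.Automorphic Literature.NumberTheory.Automorphic.UnitaryGroup
open Literature.AlgebraicGeometry.ShimuraVarieties (unitaryGroup mem_unitaryGroup_iff)

/-! ## §1 Letters: `σ`-fixed elements of `L ⊗ L⁺_v`, determinants of hermitian matrices, the central case -/

section Letters

variable {L : Type} [Field L] [NumberField L] [IsCMField L]

/-- `πᵥ ∘ (· ⊗ 1)` intertwines `σ` on `L` with `σᵥ` on `L ⊗ L⁺_v` (private copy of the (h5) letter). [cite: Rogawski1990, §3.8 p. 30] -/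
private theorem adeleToLocal_algebraMap_conj' (v : HeightOneSpectrum (𝓞 ↥(maximalRealSubfield L))) (r : L) :
    ((UnitaryGroup.adeleToLocal L v).comp (algebraMap L (AdeleRing (𝓞 L) L))) (cmConjRingHom L r) =
      UnitaryGroup.conjLocal L (IsCMField.complexConj L) v (((UnitaryGroup.adeleToLocal L v).comp (algebraMap L (AdeleRing (𝓞 L) L))) r) := by
  rw [RingHom.comp_apply, RingHom.comp_apply, ← adeleConj_algebraMap, ← UnitaryGroup.conjAdele_complexConj]
  exact UnitaryGroup.adeleToLocal_conj L (IsCMField.complexConj L) v _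

/-- The matrix of `γ_v = (γ ⊗ 1)_v ∈ GL_N(L ⊗ L⁺_v)` is the entrywise image of `γ` under `πᵥ ∘ (· ⊗ 1)` (private copy of the K6-δ′ letter; definitional).
[cite: PlatonovRapinchuk1994, §5.1] -/
private theorem coe_toLocal_toAdelic_eq_map' {N : ℕ} {H : Matrix (Fin N) (Fin N) L} (v : HeightOneSpectrum (𝓞 ↥(maximalRealSubfield L)))
    (γ : (UnitaryGroup.cmDatum L N H).Rational) :
    ((((UnitaryGroup.cmDatum L N H).toLocal v ((UnitaryGroup.cmDatum L N H).toAdelic γ)).val : GL (Fin N) (UnitaryGroup.LocalRing L v)).val :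
        Matrix (Fin N) (Fin N) (UnitaryGroup.LocalRing L v)) =
      (((γ : unitaryGroup (cmConjRingHom L) H).val : GL (Fin N) L).val : Matrix (Fin N) (Fin N) L).map
        ((UnitaryGroup.adeleToLocal L v).comp (algebraMap L (AdeleRing (𝓞 L) L))) := by
  change ((((γ : unitaryGroup (cmConjRingHom L) H).val : GL (Fin N) L).val : Matrix (Fin N) (Fin N) L).map
      (algebraMap L (AdeleRing (𝓞 L) L))).map (UnitaryGroup.adeleToLocal L v) = _
  rw [Matrix.map_map]
  rfl

/-- Blocks of equal block sums are equal (private plumbing). [cite: Rogawski1990, §3.8 p. 30] -/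
private theorem finSum_inj'' {S : Type*} [CommRing S] {N₁ N₂ : ℕ} {A C : Matrix (Fin N₁) (Fin N₁) S} {B D : Matrix (Fin N₂) (Fin N₂) S}
    (h : finSum N₁ N₂ A B = finSum N₁ N₂ C D) : A = C ∧ B = D := by
  have h' := (Matrix.reindex finSumFinEquiv finSumFinEquiv).injective h
  rw [Matrix.fromBlocks_inj] at h'
  exact ⟨h'.1, h'.2.2.2⟩

omit [NumberField L] [IsCMField L] in
/-- The CM reading of total positivity (private copy of ★ (P2-s) `re_pos_of_forall_isReal_embedding_pos`): `k ∈ L⁺` positive at every real place of `L⁺` has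
`Re τ(k) > 0` at every complex embedding `τ` of `L`. [cite: Landherr1936HermitianForms] -/
private theorem re_pos_of_forall_isReal_embedding_pos' {k : ↥(maximalRealSubfield L)}
    (hk : ∀ (v : InfinitePlace ↥(maximalRealSubfield L)) (hv : v.IsReal), 0 < InfinitePlace.embedding_of_isReal hv k) (τ : L →+* ℂ) :
    0 < (τ (k : L)).re := by
  set φ : ↥(maximalRealSubfield L) →+* ℂ := τ.comp (algebraMap ↥(maximalRealSubfield L) L) with hφ
  have hφr : ComplexEmbedding.IsReal φ := by
    rw [ComplexEmbedding.isReal_iff]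
    ext x
    exact x.2 τ
  have hv : (InfinitePlace.mk φ).IsReal := ⟨φ, hφr, rfl⟩
  have h := hk (InfinitePlace.mk φ) hv
  have he : ((InfinitePlace.embedding_of_isReal hv k : ℝ) : ℂ) = φ k := by
    rw [InfinitePlace.embedding_of_isReal_apply, InfinitePlace.embedding_mk_eq_of_isReal hφr]
  have hre : (τ (k : L)).re = InfinitePlace.embedding_of_isReal hv k := by
    have : τ (k : L) = φ k := rfl
    rw [this, ← he, Complex.ofReal_re]
  rw [hre]; exact h

/-- **`σᵥ`-FIXED ELEMENTS OF `L ⊗ L⁺_v` COME FROM `L⁺_v`**: if `(σ ⊗ 1) z = z` then `z = ι_v(a)` for some `a ∈ L⁺_v` (write `z = ι a + ι b · δ` with `σ δ = −δ`,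
★ `existsUnique_eq_add_mul`; then `2 ι b δ = 0`). [cite: Rogawski1990, §3.8 Prop. 3.8.1 (d) p. 30] -/
theorem exists_toLocalRing_eq_of_conjLocal_eq (v : HeightOneSpectrum (𝓞 ↥(maximalRealSubfield L))) {z : UnitaryGroup.LocalRing L v}
    (hz : UnitaryGroup.conjLocal L (IsCMField.complexConj L) v z = z) :
    ∃ a : v.adicCompletion ↥(maximalRealSubfield L), UnitaryGroup.toLocalRing L v a = z := by
  haveI : Algebra.IsQuadraticExtension ↥(maximalRealSubfield L) L := IsCMField.isQuadraticExtension L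
  have hex : ∃ z : L, cmConjRingHom L z ≠ z := by
    by_contra h
    apply IsCMField.complexConj_ne_one (K := L)
    ext z
    by_contra hz'
    exact h ⟨z, fun e => hz' (by rw [cmConjRingHom_apply] at e; rw [e, AlgEquiv.one_apply])⟩
  obtain ⟨δ, hδ0, hδσ⟩ := exists_ne_zero_map_eq_neg (σ := cmConjRingHom L) (IsCMField.complexConj_apply_apply L) hex
  have hcδ : IsCMField.complexConj L δ = -δ := hδσ
  obtain ⟨p, hp, -⟩ := UnitaryGroup.existsUnique_eq_add_mul L v (IsCMField.complexConj L) hcδ hδ0 z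
  -- apply `σ ⊗ 1`: the `δ`-coordinate vanishes
  have h1 : UnitaryGroup.conjLocal L (IsCMField.complexConj L) v z =
      UnitaryGroup.toLocalRing L v p.1 - UnitaryGroup.toLocalRing L v p.2 * algebraMap L (UnitaryGroup.LocalRing L v) δ := by
    conv_lhs => rw [hp]
    rw [map_add, map_mul, UnitaryGroup.conjLocal_toLocalRing, UnitaryGroup.conjLocal_toLocalRing, UnitaryGroup.conjLocal_algebraMap, hcδ, map_neg,
      mul_neg, sub_eq_add_neg]
  rw [hz] at h1
  have h2 : (2 : UnitaryGroup.LocalRing L v) * (UnitaryGroup.toLocalRing L v p.2 * algebraMap L (UnitaryGroup.LocalRing L v) δ) = 0 := by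
    have h := hp
    rw [h1] at h
    linear_combination -h
  have h2u : IsUnit (2 : UnitaryGroup.LocalRing L v) := by
    have : (2 : UnitaryGroup.LocalRing L v) = algebraMap L (UnitaryGroup.LocalRing L v) 2 := by rw [map_ofNat]
    rw [this]
    exact (isUnit_iff_ne_zero.mpr (two_ne_zero (α := L))).map _
  have h3 : UnitaryGroup.toLocalRing L v p.2 * algebraMap L (UnitaryGroup.LocalRing L v) δ = 0 := (h2u.mul_right_eq_zero).mp h2
  exact ⟨p.1, by rw [hp, h3, add_zero]⟩

/-- The determinant of a `σ`-hermitian matrix is `σ`-fixed: `(M.map σ)ᵀ = M ⇒ σ (det M) = det M`. [cite: Landherr1936HermitianForms] -/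
theorem map_det_eq_det_of_conjTranspose_eq {S : Type*} [CommRing S] (σ : S →+* S) {n : Type*} [Fintype n] [DecidableEq n] {M : Matrix n n S}
    (h : (M.map σ)ᵀ = M) : σ M.det = M.det := by
  conv_rhs => rw [← h]
  rw [Matrix.det_transpose, RingHom.map_det, RingHom.mapMatrix_apply]

/-- **The CENTRAL case**: if `γ₀ = ζ•1` then every `x ∈ U(H)(L⁺_v)` corresponding to `(γ₀)_v` IS `(γ₀)_v` (a conjugate of a scalar is the scalar), so `(γ₀)_v ~ x`.
[cite: Rogawski1990, §3.8 p. 27] -/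
theorem isConj_toLocal_of_eq_smul_one {N : ℕ} {H : Matrix (Fin N) (Fin N) L} {γ₀ : (UnitaryGroup.cmDatum L N H).Rational} {ζ : L}
    (hζ : ((((γ₀ : unitaryGroup (cmConjRingHom L) H).val : GL (Fin N) L).val : Matrix (Fin N) (Fin N) L)) = ζ • (1 : Matrix (Fin N) (Fin N) L))
    (v : HeightOneSpectrum (𝓞 ↥(maximalRealSubfield L))) (x : (UnitaryGroup.cmDatum L N H).Local v)
    (hx : Corresponds (UnitaryGroup.conjLocal L (IsCMField.complexConj L) v) ((UnitaryGroup.adelicForm L N H).map (UnitaryGroup.adeleToLocal L v))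
      ((UnitaryGroup.adelicForm L N H).map (UnitaryGroup.adeleToLocal L v)) ((UnitaryGroup.cmDatum L N H).toLocal v ((UnitaryGroup.cmDatum L N H).toAdelic γ₀)) x) :
    IsConj ((UnitaryGroup.cmDatum L N H).toLocal v ((UnitaryGroup.cmDatum L N H).toAdelic γ₀)) x := by
  have hx' : IsConj (((UnitaryGroup.cmDatum L N H).toLocal v ((UnitaryGroup.cmDatum L N H).toAdelic γ₀)).val : GL (Fin N) (UnitaryGroup.LocalRing L v))
      (x.val : GL (Fin N) (UnitaryGroup.LocalRing L v)) := hx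
  obtain ⟨c, hc⟩ := isConj_iff.1 hx'
  -- the matrix of `(γ₀)_v` is the scalar `ζ ⊗ 1`
  have hγv : ((((UnitaryGroup.cmDatum L N H).toLocal v ((UnitaryGroup.cmDatum L N H).toAdelic γ₀)).val : GL (Fin N) (UnitaryGroup.LocalRing L v)).val :
      Matrix (Fin N) (Fin N) (UnitaryGroup.LocalRing L v)) =
      ((UnitaryGroup.adeleToLocal L v).comp (algebraMap L (AdeleRing (𝓞 L) L))) ζ • (1 : Matrix (Fin N) (Fin N) (UnitaryGroup.LocalRing L v)) := by
    rw [coe_toLocal_toAdelic_eq_map', hζ, Matrix.map_smul' _ _ _ (map_mul _), Matrix.map_one _ (map_zero _) (map_one _)]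
  -- a conjugate of a scalar matrix is the scalar matrix
  have hval : (x.val : GL (Fin N) (UnitaryGroup.LocalRing L v)) = ((UnitaryGroup.cmDatum L N H).toLocal v ((UnitaryGroup.cmDatum L N H).toAdelic γ₀)).val := by
    rw [← hc]
    refine Units.ext ?_
    rw [Units.val_mul, Units.val_mul, hγv, Matrix.mul_smul, Matrix.mul_one, Matrix.smul_mul, ← Units.val_mul, mul_inv_cancel, Units.val_one]
  have hxeq : x = (UnitaryGroup.cmDatum L N H).toLocal v ((UnitaryGroup.cmDatum L N H).toAdelic γ₀) := Subtype.ext hval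
  rw [hxeq]

end Letters

/-! ## §2 The realisation -/

section Realisation

variable {L : Type} [Field L] [NumberField L] [IsCMField L] {H : Matrix (Fin 3) (Fin 3) L} {γ₀ : (UnitaryGroup.cmDatum L 3 H).Rational}

/-- **LOCAL REALISATION AT A SPLIT-SEMISIMPLE CLASS (finite places).**  `H ∈ M₃(L)` hermitian with `det H ≠ 0` (no anisotropy needed), `γ₀ ∈ U(H)(L⁺)` with
`(γ₀ − a)(γ₀ − b) = 0`, `a ≠ b`; `v` a finite place of `L⁺`, `x ∈ U(H)(L⁺_v)` with `(γ₀)_v ↔ x`.  THEN there is a rational `δ ∈ U(H)(L⁺)`, stably conjugate to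
`γ₀`, with `δ_v` conjugate to `x` IN `U(H)(L⁺_v)`.  Road in the module docstring: central case apart, frame `γ₀`, read the rank-2 block determinant class of
`x`, choose `ξ ∈ L⁺` totally positive in its `v`-adic square class (★ `NumberFields.exists_totallyPositive_eq_mul_sq`), realise `ξ` by a global `y ∈ Z(γ₀)`
(★ (R6a-s)) and `y` by `δ = g γ₀ g⁻¹` (★ R6a, Landherr), compare at `v` (★ (P1-s) non-split ∕ ★ (h2) split).
[cite: Rogawski1990, §3.3 Prop. 3.3.1 p. 22; §3.8 Prop. 3.8.1 (a)(d) pp. 27–30] [cite: Kottwitz1986, §7, §9] [cite: Landherr1936HermitianForms] -/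
theorem exists_isStablyConj_and_isConj_toLocal_of_corresponds_local (hH : (H.map (cmConjRingHom L))ᵀ = H) (hHd : H.det ≠ 0) {a b : L} (hab : a ≠ b)
    (hγ₀ : ((((γ₀ : unitaryGroup (cmConjRingHom L) H).val : GL (Fin 3) L).val : Matrix (Fin 3) (Fin 3) L) - a • (1 : Matrix (Fin 3) (Fin 3) L)) *
      ((((γ₀ : unitaryGroup (cmConjRingHom L) H).val : GL (Fin 3) L).val : Matrix (Fin 3) (Fin 3) L) - b • (1 : Matrix (Fin 3) (Fin 3) L)) = 0)
    (v : HeightOneSpectrum (𝓞 ↥(maximalRealSubfield L))) (x : (UnitaryGroup.cmDatum L 3 H).Local v)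
    (hx : Corresponds (UnitaryGroup.conjLocal L (IsCMField.complexConj L) v) ((UnitaryGroup.adelicForm L 3 H).map (UnitaryGroup.adeleToLocal L v))
      ((UnitaryGroup.adelicForm L 3 H).map (UnitaryGroup.adeleToLocal L v)) ((UnitaryGroup.cmDatum L 3 H).toLocal v ((UnitaryGroup.cmDatum L 3 H).toAdelic γ₀)) x) :
    ∃ δ : (UnitaryGroup.cmDatum L 3 H).Rational,
      IsStablyConj (cmConjRingHom L) H (γ₀ : unitaryGroup (cmConjRingHom L) H) (δ : unitaryGroup (cmConjRingHom L) H) ∧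
        IsConj ((UnitaryGroup.cmDatum L 3 H).toLocal v ((UnitaryGroup.cmDatum L 3 H).toAdelic δ)) x := by
  classical
  -- the central case
  by_cases hα : ((((γ₀ : unitaryGroup (cmConjRingHom L) H).val : GL (Fin 3) L).val : Matrix (Fin 3) (Fin 3) L)) = a • (1 : Matrix (Fin 3) (Fin 3) L)
  · exact ⟨γ₀, IsStablyConj.refl _, isConj_toLocal_of_eq_smul_one hα v x hx⟩
  by_cases hβ : ((((γ₀ : unitaryGroup (cmConjRingHom L) H).val : GL (Fin 3) L).val : Matrix (Fin 3) (Fin 3) L)) = b • (1 : Matrix (Fin 3) (Fin 3) L)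
  · exact ⟨γ₀, IsStablyConj.refl _, isConj_toLocal_of_eq_smul_one hβ v x hx⟩
  -- the frame of `γ₀`
  obtain ⟨a₁, b₁, P, Ha, Hb, hab₁, -, -, hP, hγP, hHa, hHb, hda, hdb⟩ :=
    exists_singular_frame (cmConjRingHom L) (IsCMField.complexConj_apply_apply L) H hH hHd (γ₀ : unitaryGroup (cmConjRingHom L) H) hab hγ₀ hα hβ
  have hab₁' : a₁ ≠ b₁ := by
    rcases hab₁ with ⟨rfl, rfl⟩ | ⟨rfl, rfl⟩
    · exact hab
    · exact hab.symm
  -- LETTERS at `v`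
  set 𝔸 := AdeleRing (𝓞 L) L with h𝔸
  set πv := UnitaryGroup.adeleToLocal L v with hπv
  set σv := UnitaryGroup.conjLocal L (IsCMField.complexConj L) v with hσv
  set F : L →+* UnitaryGroup.LocalRing L v := πv.comp (algebraMap L 𝔸) with hFdef
  have hF : ∀ r : L, F (cmConjRingHom L r) = σv (F r) := fun r => adeleToLocal_algebraMap_conj' v r
  have hFalg : ∀ r : L, F r = algebraMap L (UnitaryGroup.LocalRing L v) r := fun r =>
    DFunLike.congr_fun (UnitaryGroup.adeleToLocal_comp_algebraMap (E := L) v) r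
  haveI : Algebra.IsQuadraticExtension ↥(maximalRealSubfield L) L := IsCMField.isQuadraticExtension L
  have hex : ∃ z : L, cmConjRingHom L z ≠ z := by
    by_contra h
    apply IsCMField.complexConj_ne_one (K := L)
    ext z
    by_contra hz
    exact h ⟨z, fun e => hz (by rw [cmConjRingHom_apply] at e; rw [e, AlgEquiv.one_apply])⟩
  obtain ⟨δ', hδ0, hδσ⟩ := exists_ne_zero_map_eq_neg (σ := cmConjRingHom L) (IsCMField.complexConj_apply_apply L) hex
  have hcδ : IsCMField.complexConj L δ' = -δ' := hδσ
  have hσσv : ∀ z, σv (σv z) = z := Liu2021.LemD1OfPlace.conjLocal_conjLocal_apply L v (IsCMField.complexConj L) hcδ hδ0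
  have hσF : (⇑σv ∘ ⇑F : L → UnitaryGroup.LocalRing L v) = ⇑F ∘ ⇑(cmConjRingHom L) := funext fun r => (hF r).symm
  -- names for the mapped objects
  set Hv : Matrix (Fin 3) (Fin 3) (UnitaryGroup.LocalRing L v) := (H.map (algebraMap L 𝔸)).map πv with hHv
  have hHvF : Hv = H.map F := by rw [hHv, Matrix.map_map]; rfl
  set Pv : GL (Fin 3) (UnitaryGroup.LocalRing L v) := Matrix.GeneralLinearGroup.map F P with hPvdef
  have hPv : Pv.val = (P : Matrix (Fin 3) (Fin 3) L).map F := rfl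
  -- the GL₃-level conjugacy `(γ₀)_v ~ x`, and `(γ₀)_v` as `GL₃(F) γ₀`
  have hx' : IsConj (((UnitaryGroup.cmDatum L 3 H).toLocal v ((UnitaryGroup.cmDatum L 3 H).toAdelic γ₀)).val : GL (Fin 3) (UnitaryGroup.LocalRing L v))
      (x.val : GL (Fin 3) (UnitaryGroup.LocalRing L v)) := hx
  have hγGLF : (((UnitaryGroup.cmDatum L 3 H).toLocal v ((UnitaryGroup.cmDatum L 3 H).toAdelic γ₀)).val : GL (Fin 3) (UnitaryGroup.LocalRing L v)) =
      Matrix.GeneralLinearGroup.map F ((γ₀ : unitaryGroup (cmConjRingHom L) H).val : GL (Fin 3) L) :=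
    Units.ext (coe_toLocal_toAdelic_eq_map' v γ₀)
  rw [hγGLF] at hx'
  set γGL : GL (Fin 3) (UnitaryGroup.LocalRing L v) := Matrix.GeneralLinearGroup.map F ((γ₀ : unitaryGroup (cmConjRingHom L) H).val : GL (Fin 3) L) with hγGL
  have hγvF : (γGL.val : Matrix (Fin 3) (Fin 3) (UnitaryGroup.LocalRing L v)) = ((((γ₀ : unitaryGroup (cmConjRingHom L) H).val : GL (Fin 3) L) :
      Matrix (Fin 3) (Fin 3) L)).map F := rfl
  -- unit determinants
  have hHu : IsUnit H.det := isUnit_iff_ne_zero.mpr hHd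
  have hHvd : IsUnit Hv.det := by rw [hHvF, ← RingHom.mapMatrix_apply, ← RingHom.map_det]; exact hHu.map F
  have hFab : IsUnit (F a₁ - F b₁) := by rw [← map_sub]; exact (IsUnit.mk0 _ (sub_ne_zero.mpr hab₁')).map F
  have hσvHv : (Hv.map σv)ᵀ = Hv := by
    rw [hHvF, Matrix.map_map, hσF, ← Matrix.map_map, ← Matrix.transpose_map, hH]
  -- (1) the frame at `v`
  have hPv_frame : twistGram σv Hv Pv.val = finSum 2 1 (Ha.map F) (Hb.map F) := by
    rw [hHvF, hPv, ← twistGram_map (cmConjRingHom L) H σv F hF, twistGram_def, hP, finSum_map]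
  have hsmul1 : ∀ (n : ℕ) (c : L), (c • (1 : Matrix (Fin n) (Fin n) L)).map F = F c • (1 : Matrix (Fin n) (Fin n) (UnitaryGroup.LocalRing L v)) :=
    fun n c => by rw [Matrix.map_smul' _ _ _ (map_mul F), Matrix.map_one _ (map_zero F) (map_one F)]
  have hγv_frame : (γGL.val : Matrix (Fin 3) (Fin 3) (UnitaryGroup.LocalRing L v)) * Pv.val =
      Pv.val * finSum 2 1 (F a₁ • (1 : Matrix (Fin 2) (Fin 2) (UnitaryGroup.LocalRing L v))) (F b₁ • (1 : Matrix (Fin 1) (Fin 1) (UnitaryGroup.LocalRing L v))) := by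
    rw [hγvF, hPv, ← Matrix.map_mul, hγP, Matrix.map_mul, finSum_map, hsmul1, hsmul1]
  -- (2) the conjugator of `x` and the block form of its transported form
  obtain ⟨g', hg'⟩ := isConj_iff.1 hx'
  set G' : Matrix (Fin 3) (Fin 3) (UnitaryGroup.LocalRing L v) := twistGram σv Hv (g'.val : Matrix (Fin 3) (Fin 3) (UnitaryGroup.LocalRing L v)) with hG'def
  have hG' : (G'.map σv)ᵀ = G' := conjTranspose_twistGram σv Hv hσσv hσvHv _
  have hg'd : IsUnit (g'.val : Matrix (Fin 3) (Fin 3) (UnitaryGroup.LocalRing L v)).det := Matrix.isUnits_det_units g'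
  have hG'd : IsUnit G'.det := by rw [hG'def, det_twistGram]; exact ((hg'd.map σv).mul hHvd).mul hg'd
  have hx_mem : (x.val : GL (Fin 3) (UnitaryGroup.LocalRing L v)) ∈ unitaryGroup σv Hv := mem_unitaryGroup_iff.2 (mem_unitaryGroupOfForm_iff.1 x.2)
  have hγ_mem : γGL ∈ unitaryGroup σv Hv := by
    rw [← hγGLF]
    exact mem_unitaryGroup_iff.2 (mem_unitaryGroupOfForm_iff.1 ((UnitaryGroup.cmDatum L 3 H).toLocal v ((UnitaryGroup.cmDatum L 3 H).toAdelic γ₀)).2)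
  have hx_comm : Hv⁻¹ * G' * (γGL.val : Matrix (Fin 3) (Fin 3) (UnitaryGroup.LocalRing L v)) =
      (γGL.val : Matrix (Fin 3) (Fin 3) (UnitaryGroup.LocalRing L v)) * (Hv⁻¹ * G') :=
    (commute_inv_mul_twistGram σv Hv hHvd (γ := ⟨γGL, hγ_mem⟩) (δ := ⟨x.val, hx_mem⟩) hg').eq
  obtain ⟨y₁, y₂, hG'P⟩ := exists_twistGram_frame_eq_finSum (N₁ := 2) (N₂ := 1) σv hHvd hFab hPv_frame hγv_frame hx_comm
  change Matrix (Fin 2) (Fin 2) (UnitaryGroup.LocalRing L v) at y₁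
  change twistGram σv G' Pv.val = finSum 2 1 (Ha.map F * y₁) (Hb.map F * y₂) at hG'P
  -- (3) the rank-2 block determinant class of `x`: a `σᵥ`-fixed unit, hence from `L⁺_v`
  have hPu : IsUnit Pv.val.det := Matrix.isUnits_det_units Pv
  have hPG' : ((twistGram σv G' Pv.val).map σv)ᵀ = twistGram σv G' Pv.val := conjTranspose_twistGram σv G' hσσv hG' _
  rw [hG'P, transpose_finSum_map] at hPG'
  have hblk : ((Ha.map F * y₁).map σv)ᵀ = Ha.map F * y₁ := (finSum_inj'' hPG').1
  have hHaF : ((Ha.map F).map σv)ᵀ = Ha.map F := by rw [Matrix.map_map, hσF, ← Matrix.map_map, ← Matrix.transpose_map, hHa]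
  have hdHaF : IsUnit (Ha.map F).det := by
    rw [← RingHom.mapMatrix_apply, ← RingHom.map_det]; exact (IsUnit.mk0 _ hda).map F
  have hdblk : IsUnit (Ha.map F * y₁).det := by
    have h : (Ha.map F * y₁).det * (Hb.map F * y₂).det = σv Pv.val.det * G'.det * Pv.val.det := by rw [← det_finSum, ← hG'P, det_twistGram]
    exact isUnit_of_mul_isUnit_left (h ▸ ((hPu.map σv).mul hG'd).mul hPu)
  obtain ⟨c₁, hc₁⟩ := exists_toLocalRing_eq_of_conjLocal_eq v (map_det_eq_det_of_conjTranspose_eq σv hblk)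
  obtain ⟨c₂, hc₂⟩ := exists_toLocalRing_eq_of_conjLocal_eq v (map_det_eq_det_of_conjTranspose_eq σv hHaF)
  have hc₁0 : c₁ ≠ 0 := by
    rintro rfl
    rw [map_zero] at hc₁
    exact not_isUnit_zero (hc₁ ▸ hdblk)
  have hc₂0 : c₂ ≠ 0 := by
    rintro rfl
    rw [map_zero] at hc₂
    exact not_isUnit_zero (hc₂ ▸ hdHaF)
  -- (4) `ξ ∈ L⁺` totally positive with `ξ ⊗ 1 = (c₁ ∕ c₂) · s²`
  obtain ⟨t, s, htpos, hts⟩ := NumberFields.exists_totallyPositive_eq_mul_sq v (Units.mk0 (c₁ / c₂) (div_ne_zero hc₁0 hc₂0))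
  set ξ : L := ((t : ↥(maximalRealSubfield L)) : L) with hξdef
  have hξσ : cmConjRingHom L ξ = ξ := by
    rw [cmConjRingHom_apply, hξdef]
    exact IsCMField.complexConj_apply_eq_self (K := L) (t : ↥(maximalRealSubfield L))
  have hξpos : ∀ τ : L →+* ℂ, 0 < (τ ξ).re :=
    re_pos_of_forall_isReal_embedding_pos' (NumberFields.forall_isReal_pos_of_forall_embedding_pos htpos)
  have hFξ : F ξ * (Ha.map F).det = (Ha.map F * y₁).det * (UnitaryGroup.toLocalRing L v (s : v.adicCompletion ↥(maximalRealSubfield L)) *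
      UnitaryGroup.toLocalRing L v (s : v.adicCompletion ↥(maximalRealSubfield L))) := by
    have h1 : F ξ = UnitaryGroup.toLocalRing L v ((t : ↥(maximalRealSubfield L)) : v.adicCompletion ↥(maximalRealSubfield L)) := by
      rw [UnitaryGroup.toLocalRing_coe, hξdef]
      exact hFalg _
    -- in the field `L⁺_v`: `t · c₂ = c₁ · s²`
    have hts' : ((t : ↥(maximalRealSubfield L)) : v.adicCompletion ↥(maximalRealSubfield L)) =
        c₁ / c₂ * (s : v.adicCompletion ↥(maximalRealSubfield L)) ^ 2 := by
      have h := hts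
      rw [Units.val_mk0] at h
      exact h
    have h2 : ((t : ↥(maximalRealSubfield L)) : v.adicCompletion ↥(maximalRealSubfield L)) * c₂ = c₁ * ((s : v.adicCompletion ↥(maximalRealSubfield L)) *
        (s : v.adicCompletion ↥(maximalRealSubfield L))) := by
      rw [hts']
      field_simp
    rw [h1, ← hc₁, ← hc₂, ← map_mul, h2, map_mul, map_mul]
  -- (5) the global `⋆`-symmetric unit `y ∈ Z(γ₀)` of class `ξ` and its realisation `δ = g γ₀ g⁻¹`
  obtain ⟨y, Ya, Yb, -, hyγ, hys, hy1, -, -, hYa, -, hyP, hsig⟩ :=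
    exists_commute_hermStar_eq_of_frame hH hHd ((((γ₀ : unitaryGroup (cmConjRingHom L) H).val : GL (Fin 3) L).val : Matrix (Fin 3) (Fin 3) L))
      hP hγP hHa hHb hda hdb hξσ hξpos
  obtain ⟨g, δ, hgδ, hst, hcart⟩ := exists_unitary_conj_inv_mul_twistGram_eq_of_invariants (L := L) hH hHd (γ₀ : unitaryGroup (cmConjRingHom L) H) hyγ hys
    (by rw [hy1]; exact one_ne_zero) hsig ⟨1, one_ne_zero, by rw [hy1, map_one, mul_one]⟩
  refine ⟨δ, hst, ?_⟩
  -- (6) at `v`: the transported form of `g ⊗ 1` is `(H y) ⊗ 1`, framed as `Y_a ⊕ Y_b`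
  set gv : GL (Fin 3) (UnitaryGroup.LocalRing L v) := Matrix.GeneralLinearGroup.map F g with hgvdef
  -- `δ_v` as `GL₃(F) δ` (no `set`: abstracting this term over the context is expensive)
  have hδGLF : (((UnitaryGroup.cmDatum L 3 H).toLocal v ((UnitaryGroup.cmDatum L 3 H).toAdelic δ)).val : GL (Fin 3) (UnitaryGroup.LocalRing L v)) =
      Matrix.GeneralLinearGroup.map F ((δ : unitaryGroup (cmConjRingHom L) H).val : GL (Fin 3) L) :=
    Units.ext (coe_toLocal_toAdelic_eq_map' v δ)
  have hgv : gv * γGL * gv⁻¹ = Matrix.GeneralLinearGroup.map F ((δ : unitaryGroup (cmConjRingHom L) H).val : GL (Fin 3) L) := by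
    rw [hgvdef, hγGL, ← map_inv, ← map_mul, ← map_mul, hgδ]
  have hHg : twistGram (cmConjRingHom L) H (g : Matrix (Fin 3) (Fin 3) L) = H * y := by
    rw [← hcart, Matrix.mul_nonsing_inv_cancel_left _ _ hHu]
  have hGv : twistGram σv Hv (gv.val : Matrix (Fin 3) (Fin 3) (UnitaryGroup.LocalRing L v)) = (H * y).map F := by
    rw [hHvF, hgvdef]
    change twistGram σv (H.map F) ((g : Matrix (Fin 3) (Fin 3) L).map F) = _
    rw [← twistGram_map (cmConjRingHom L) H σv F hF, hHg]
  have hGP : twistGram σv (twistGram σv Hv (gv.val : Matrix (Fin 3) (Fin 3) (UnitaryGroup.LocalRing L v))) Pv.val = finSum 2 1 (Ya.map F) (Yb.map F) := by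
    rw [hGv, hPv, ← twistGram_map (cmConjRingHom L) (H * y) σv F hF, twistGram_def, hyP, finSum_map]
  -- (7) conjugacy in `U(H)(L⁺_v)`: split places (h2), non-split places (P1-s) with the rank-2 determinant class matched by `ξ`
  obtain ⟨w⟩ : Nonempty (UnitaryGroup.PlacesOver L v) := inferInstance
  have hconj : ∃ u : GL (Fin 3) (UnitaryGroup.LocalRing L v), u ∈ unitaryGroup σv Hv ∧
      u * Matrix.GeneralLinearGroup.map F ((δ : unitaryGroup (cmConjRingHom L) H).val : GL (Fin 3) L) * u⁻¹ = (x.val : GL (Fin 3) (UnitaryGroup.LocalRing L v)) := by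
    by_cases hw : IsCMField.complexConj L • w.1 = w.1
    · refine exists_unitary_conj_of_det_blocks L v (IsCMField.complexConj L) hcδ hδ0 w hw hσvHv hHvd hg' hgv hγv_frame hG'P hGP ?_
      refine ⟨UnitaryGroup.toLocalRing L v (s : v.adicCompletion ↥(maximalRealSubfield L)), ?_, ?_⟩
      · exact (Units.isUnit s).map _
      · rw [UnitaryGroup.conjLocal_toLocalRing, ← RingHom.mapMatrix_apply F Ya, ← RingHom.map_det, hYa, map_mul, RingHom.map_det, RingHom.mapMatrix_apply]
        exact hFξ
    · exact exists_unitary_conj_of_split_frame L v (IsCMField.complexConj L) hcδ hδ0 w hw hσvHv hHvd hg' hgv hγv_frame hG'P hGP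
  obtain ⟨u, hu, hux⟩ := hconj
  rw [← hδGLF] at hux
  have hu' : u ∈ UnitaryGroup.«local» L (IsCMField.complexConj L) 3 H v := mem_unitaryGroupOfForm_iff.2 (mem_unitaryGroup_iff.1 hu)
  exact isConj_iff.2 ⟨⟨u, hu'⟩, Subtype.ext hux⟩

/-- **The `hLR` shape of the (ANCHOR-s) certificate** (`∀ v x`, conclusion as conjugacy of `δ_v` with `x`): for `γ₀` with `(γ₀ − a)(γ₀ − b) = 0`, `a ≠ b`.
[cite: Rogawski1990, §3.3 Prop. 3.3.1 p. 22; §3.8 Prop. 3.8.1 (d) p. 30] [cite: Kottwitz1986, §7, §9] -/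
theorem forall_exists_isStablyConj_and_isConj_toLocal_of_mul_sub_eq_zero (hH : (H.map (cmConjRingHom L))ᵀ = H) (hHd : H.det ≠ 0) {a b : L} (hab : a ≠ b)
    (hγ₀ : ((((γ₀ : unitaryGroup (cmConjRingHom L) H).val : GL (Fin 3) L).val : Matrix (Fin 3) (Fin 3) L) - a • (1 : Matrix (Fin 3) (Fin 3) L)) *
      ((((γ₀ : unitaryGroup (cmConjRingHom L) H).val : GL (Fin 3) L).val : Matrix (Fin 3) (Fin 3) L) - b • (1 : Matrix (Fin 3) (Fin 3) L)) = 0) :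
    ∀ (v : HeightOneSpectrum (𝓞 ↥(maximalRealSubfield L))) (x : (UnitaryGroup.cmDatum L 3 H).Local v),
      Corresponds (UnitaryGroup.conjLocal L (IsCMField.complexConj L) v) ((UnitaryGroup.adelicForm L 3 H).map (UnitaryGroup.adeleToLocal L v))
        ((UnitaryGroup.adelicForm L 3 H).map (UnitaryGroup.adeleToLocal L v)) ((UnitaryGroup.cmDatum L 3 H).toLocal v ((UnitaryGroup.cmDatum L 3 H).toAdelic γ₀)) x →
      ∃ δ : (UnitaryGroup.cmDatum L 3 H).Rational,
        IsStablyConj (cmConjRingHom L) H (γ₀ : unitaryGroup (cmConjRingHom L) H) (δ : unitaryGroup (cmConjRingHom L) H) ∧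
          IsConj ((UnitaryGroup.cmDatum L 3 H).toLocal v ((UnitaryGroup.cmDatum L 3 H).toAdelic δ)) x :=
  fun v x hx => exists_isStablyConj_and_isConj_toLocal_of_corresponds_local hH hHd hab hγ₀ v x hx

end Realisation

end Literature.NumberTheory.Rogawski1990

end
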